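import Mathlib
import HarnessLib
import Summits.NavierStokesRegularity.NavierStokesRegularity.Theorems.UnthreadedRigidityDoorUnthreadedRigidityPersistenceGradSqAffineLaw
import Summits.NavierStokesRegularity.NavierStokesRegularity.Theorems.UnthreadedRigidityDoorUnthreadedRigidityVirialHornBracketTwo
import Summits.NavierStokesRegularity.NavierStokesRegularity.Theorems.UnthreadedRigidityDoorUnthreadedRigidityTwoShellTopComponent

/-!
# Route `UnthreadedDoor` / `ThreadingFlux`, crux `PoloidalLiouville` (stmt-NavierStokesRegularity-1222), antidynamo v2 skeleton,
# rung `stub_singleDegreeRung`, EVEN degree — THE ZONAL LEMMA (quadratic sphere law): `|∇P|² = a + bP + cP²` on `S²` for a nonzero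
# solid harmonic `P` of degree `l ≥ 2` forces `c = 0`, `l = 2` and `P` zonal

Support file (census instrument decomp-ns-census-1 g30, cell decomp-ns; `--supports stmt-NavierStokesRegularity-1222 --as helper`; 0 kit).

The even-degree rung's bridge (E2)→(E3) (`psi_sphereConst_of_lamb_identity`, p800631) makes the scalar
`Ψ = −½c(r)P² − d(r)|∇P|² − e(r)P` constant on every sphere; wherever `d ≠ 0`, homogeneity turns this into the QUADRATIC SPHERE LAW
`|∇P|² ∈ span{1, P, P²}` on `S²`.  The leaf hand's exit summary (2026-08-31T01:26Z) and the cell's census (ZONAL-LEMMA-census-g28.md, evidence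
on 1222; critic decomp-ns-crit-1 g8 row 340) name the algebraic lemma «quadratic/affine `|∇P|²` on `S²` ⟹ `l = 2` zonal» as the rung's idea step
and prove it on paper.  THIS FILE MAKES IT A TREE THEOREM BY REUSE — almost all of it was already in the tree under the sibling route
`UnthreadedRigidityDoor` (W2):

* the AFFINE case is `Persistence.gradSqAffineLaw` (`…PersistenceGradSqAffineLaw`, VERBATIM support S–M of the persistence line):
  `|∇Y|² = aY + c` on `S²`, `Y` a nonzero solid harmonic of degree `l ≥ 2` ⟹ `l = 2 ∧ IsZonal Y`;
* the NULL-CONE CHART `Zonal.chartT` (W1, `ThreadingFluxHorizonTowerNullConeChart`/`…Injective`) kills exactly the multiples of `|x|²` and is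
  injective on solid harmonics; `MixedPair.chartT_map_sq_ne_zero` (`…TwoShellTopComponent`): `chartT(P²) ≠ 0` for a nonzero real solid harmonic.

What is added here is the one missing step, PARITY-FREE:

* `evalE_sq_law_poly_eq_zero` — homogenising the sphere law and SQUARING removes the odd power `|x|^l`:
  `(|x|²·(∇P·∇P) − a|x|^{2l} − cP²)² − b²|x|^{2l}P² ≡ 0` as a polynomial FUNCTION, hence (`Zonal.eq_zero_of_evalE_eq_zero`) as a POLYNOMIAL;
* ★ `sphereLaw_coeff_sq_eq_zero` — applying `chartT` leaves `c²·chartT(P²)² = 0`, so `c = 0` (any degree `l ≥ 1`);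
* ★★ `gradSqQuadraticLaw` — hence, for `l ≥ 2`, the quadratic law reduces to the affine law and `gradSqAffineLaw` gives `l = 2 ∧ IsZonal Y`
  (`Y`-currency of the VIRIAL HORN files: `IsSolidHarmonic l Y`);
* `zonalLemma` — the same in the rung's polynomial currency (`P : MvPolynomial (Fin 3) ℝ`, `P.IsHomogeneous l`, `Zonal.lapP P = 0`, `P ≠ 0`);
* `zonalLemma_of_laplacian` — the same with the harmonicity hypothesis spelled with Mathlib's `Laplacian.laplacian` of the polynomial function,
  exactly as in `StubSingleDegreeRung` (`…AntidynamoSingleDegreeRungOfCrux`);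
* `not_quadraticSphereLaw_of_three_le` — in degree `l ≥ 3` NO nonzero solid harmonic obeys a quadratic sphere law.

HONEST LABEL: classical algebra of solid harmonics serving the open EVEN-degree rung of an S-free Liouville engine; the rung, the wall
`stub_scalarLiouville`, `PoloidalLiouville` (1222) and Navier–Stokes regularity are NOT touched (crux 1222 is INCOMPARABLE with the summit;
this is descent inside the door's cone, decorative for the summit).  Nothing here proves NavierStokesRegularity.  [folklore]
-/

noncomputable section

-- the summit and its single sub-problem share the name (CONVENTIONS §1), as in every Theorems file
set_option linter.dupNamespace false

namespace Summit.NavierStokesRegularity.NavierStokesRegularity.Theorems.PoloidalLiouville.Antidynamo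

open MvPolynomial
open scoped Polynomial
-- `Zonal.*` = the W1 polynomial calculus (`evalE`, `dotP`, `lapP`, `chartT`, …) of `…Theorems.PoloidalLiouville.HorizonTower.Zonal`
open Summit.NavierStokesRegularity.NavierStokesRegularity.Theorems.PoloidalLiouville.HorizonTower
open Summit.NavierStokesRegularity.NavierStokesRegularity.Theorems.UnthreadedRigidity.VirialHorn
  (IsSolidHarmonic IsZonal IsZonalAbout det3 isSolidHarmonic_evalE IsSolidHarmonic.exists_evalE)
open Summit.NavierStokesRegularity.NavierStokesRegularity.Theorems.UnthreadedRigidity.MixedPair (chartT_map_sq_ne_zero)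
open Summit.NavierStokesRegularity.NavierStokesRegularity.Theorems.UnthreadedRigidity.Persistence (gradSqAffineLaw)

variable {l : ℕ} {P : MvPolynomial (Fin 3) ℝ} {a b c : ℝ}

/-! ## Evaluation bookkeeping -/

/-- `evalE (p ^ k) = (evalE p) ^ k`. [folklore] -/
theorem evalE_pow (p : MvPolynomial (Fin 3) ℝ) (k : ℕ) (y : EuclideanSpace ℝ (Fin 3)) : Zonal.evalE (p ^ k) y = Zonal.evalE p y ^ k := by
  simp [Zonal.evalE]

/-- `|x|²` evaluates to `‖y‖²`. [folklore] -/
theorem evalE_normSq (y : EuclideanSpace ℝ (Fin 3)) : Zonal.evalE (X 0 ^ 2 + X 1 ^ 2 + X 2 ^ 2 : MvPolynomial (Fin 3) ℝ) y = ‖y‖ ^ 2 := by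
  rw [EuclideanSpace.real_norm_sq_eq, Fin.sum_univ_three]
  simp [Zonal.evalE]

/-- `(∇P·∇P)(y) = ‖∇P(y)‖²` pointwise (the tree's `Zonal.norm_gradient_sq_evalE`). [folklore] -/
theorem evalE_dotP_self (p : MvPolynomial (Fin 3) ℝ) (y : EuclideanSpace ℝ (Fin 3)) :
    Zonal.evalE (Zonal.dotP p p) y = ‖gradient (Zonal.evalE p) y‖ ^ 2 :=
  (congrFun (Zonal.norm_gradient_sq_evalE p) y).symm

/-! ## The homogenised, squared sphere law is a polynomial identity -/

/-- THE SQUARED LAW VANISHES AS A FUNCTION: if `‖∇P‖² = a + bP + cP²` on `S²` for a solid harmonic `P` of degree `m + 1`, then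
`(|x|²(∇P·∇P) − a|x|^{2m+2} − cP²)² − b²|x|^{2m+2}P²` vanishes at every point of `ℝ³` (homogeneity `P(ry) = r^{m+1}P(y)`,
`∇P(ry) = r^m ∇P(y)` off the origin; both sides vanish at the origin). [folklore] -/
theorem evalE_sq_law_eq_zero {m : ℕ} (hP : P.IsHomogeneous (m + 1)) (hlap : Zonal.lapP P = 0)
    (hlaw : ∀ y : EuclideanSpace ℝ (Fin 3), ‖y‖ = 1 →
      ‖gradient (Zonal.evalE P) y‖ ^ 2 = a + b * Zonal.evalE P y + c * Zonal.evalE P y ^ 2) (y : EuclideanSpace ℝ (Fin 3)) :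
    Zonal.evalE (((X 0 ^ 2 + X 1 ^ 2 + X 2 ^ 2) * Zonal.dotP P P - (X 0 ^ 2 + X 1 ^ 2 + X 2 ^ 2) ^ (m + 1) * C a
        - C c * (P * P)) ^ 2 - (X 0 ^ 2 + X 1 ^ 2 + X 2 ^ 2) ^ (m + 1) * (C (b ^ 2) * (P * P))) y = 0 := by
  have hY : IsSolidHarmonic (m + 1) (Zonal.evalE P) := isSolidHarmonic_evalE hP hlap
  simp only [Zonal.evalE_sub, Zonal.evalE_mul, evalE_pow, Zonal.evalE_C, evalE_normSq, evalE_dotP_self]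
  by_cases hy : y = 0
  · -- at the origin `P = 0` and `|x| = 0`
    have hP0 : Zonal.evalE P 0 = 0 := by
      have h := hY.apply_smul 0 (0 : EuclideanSpace ℝ (Fin 3))
      rw [zero_smul, zero_pow (Nat.succ_ne_zero m), zero_mul] at h
      exact h
    subst hy
    rw [hP0, norm_zero, zero_pow two_ne_zero, zero_pow (Nat.succ_ne_zero m)]
    ring
  · -- off the origin: `y = r • u`, `‖u‖ = 1`, `r = ‖y‖ > 0`
    have hr : 0 < ‖y‖ := norm_pos_iff.2 hy
    obtain ⟨r, u, hr0, hu1, rfl⟩ : ∃ (r : ℝ) (u : EuclideanSpace ℝ (Fin 3)), 0 < r ∧ ‖u‖ = 1 ∧ y = r • u :=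
      ⟨‖y‖, ‖y‖⁻¹ • y, hr, by rw [norm_smul, norm_inv, norm_norm, inv_mul_cancel₀ hr.ne'],
        by rw [smul_smul, mul_inv_cancel₀ hr.ne', one_smul]⟩
    have hg := hlaw u hu1
    have hp : Zonal.evalE P (r • u) = r ^ (m + 1) * Zonal.evalE P u := hY.apply_smul r u
    have hgrad : gradient (Zonal.evalE P) (r • u) = r ^ m • gradient (Zonal.evalE P) u := by
      rw [hY.gradient_smul r hr0 u]
      congr 1
      rw [show ((m + 1 : ℕ) : ℤ) - 1 = ((m : ℕ) : ℤ) by push_cast; ring, zpow_natCast]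
    have hG : ‖gradient (Zonal.evalE P) (r • u)‖ ^ 2 = (r ^ m) ^ 2 * ‖gradient (Zonal.evalE P) u‖ ^ 2 := by
      rw [hgrad, norm_smul, Real.norm_eq_abs, abs_of_nonneg (pow_nonneg hr0.le m), mul_pow]
    have hnorm : ‖r • u‖ = r := by rw [norm_smul, Real.norm_eq_abs, abs_of_nonneg hr0.le, hu1, mul_one]
    rw [hnorm, hG, hp, hg]
    ring

/-- THE SQUARED LAW VANISHES AS A POLYNOMIAL (`ℝ` is infinite: `Zonal.eq_zero_of_evalE_eq_zero`). [folklore] -/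
theorem sq_law_poly_eq_zero {m : ℕ} (hP : P.IsHomogeneous (m + 1)) (hlap : Zonal.lapP P = 0)
    (hlaw : ∀ y : EuclideanSpace ℝ (Fin 3), ‖y‖ = 1 →
      ‖gradient (Zonal.evalE P) y‖ ^ 2 = a + b * Zonal.evalE P y + c * Zonal.evalE P y ^ 2) :
    (((X 0 ^ 2 + X 1 ^ 2 + X 2 ^ 2) * Zonal.dotP P P - (X 0 ^ 2 + X 1 ^ 2 + X 2 ^ 2) ^ (m + 1) * C a
        - C c * (P * P)) ^ 2 - (X 0 ^ 2 + X 1 ^ 2 + X 2 ^ 2) ^ (m + 1) * (C (b ^ 2) * (P * P)) : MvPolynomial (Fin 3) ℝ) = 0 :=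
  Zonal.eq_zero_of_evalE_eq_zero (evalE_sq_law_eq_zero hP hlap hlaw)

/-! ## ★ The null-cone step: the `P²` coefficient vanishes -/

/-- ★ **NULL-CONE STEP.**  For a NONZERO real solid harmonic `P` of degree `l ≥ 1` with `‖∇P‖² = a + bP + cP²` on `S²`: `c = 0`.
PROOF.  Map the polynomial identity `sq_law_poly_eq_zero` to `ℂ` and apply the isotropic chart `chartT` (a ring map killing every multiple of
`|x|²`, `Zonal.chartT_normSq_mul`): what survives is `(c · chartT(P²))² = 0` in `ℂ[t]`, and `chartT(P²) ≠ 0` (`MixedPair.chartT_map_sq_ne_zero`: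
`|x|² ∤ P²` for a nonzero real harmonic), so `c = 0`. [folklore] -/
theorem sphereLaw_coeff_sq_eq_zero (hl : 1 ≤ l) (hP : P.IsHomogeneous l) (hlap : Zonal.lapP P = 0) (h0 : P ≠ 0)
    (hlaw : ∀ y : EuclideanSpace ℝ (Fin 3), ‖y‖ = 1 →
      ‖gradient (Zonal.evalE P) y‖ ^ 2 = a + b * Zonal.evalE P y + c * Zonal.evalE P y ^ 2) : c = 0 := by
  obtain ⟨m, rfl⟩ := Nat.exists_eq_add_of_le' hl
  have hQ := sq_law_poly_eq_zero hP hlap hlaw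
  -- map to `ℂ` and take the chart
  have hT := congrArg (fun q : MvPolynomial (Fin 3) ℝ => Zonal.chartT (map (algebraMap ℝ ℂ) q)) hQ
  simp only [map_sub, map_pow, map_mul, map_add, map_X, map_C, Zonal.map_dotP, map_zero, Zonal.chartT_zero] at hT
  rw [Zonal.chartT_sub, Zonal.chartT_pow, Zonal.chartT_sub, Zonal.chartT_sub, Zonal.chartT_normSq_mul,
    Zonal.chartT_normSq_pow_mul _ (Nat.le_add_left 1 m), Zonal.chartT_normSq_pow_mul _ (Nat.le_add_left 1 m),
    Zonal.chartT_mul, Zonal.chartT_C] at hT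
  simp only [zero_sub, sub_zero] at hT
  -- `hT : (-(C c · chartT(P_ℂ P_ℂ)))² = 0`
  have hne : Zonal.chartT (map (algebraMap ℝ ℂ) P * map (algebraMap ℝ ℂ) P) ≠ 0 := by
    rw [← map_mul]
    exact chartT_map_sq_ne_zero hP hlap h0
  have h1 : Polynomial.C (algebraMap ℝ ℂ c) * Zonal.chartT (map (algebraMap ℝ ℂ) P * map (algebraMap ℝ ℂ) P) = 0 := by
    have h2 := pow_eq_zero_iff (n := 2) two_ne_zero |>.mp hT
    rwa [neg_eq_zero] at h2
  rcases mul_eq_zero.mp h1 with hc | hT0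
  · have : (algebraMap ℝ ℂ c) = 0 := Polynomial.C_eq_zero.mp hc
    exact (map_eq_zero_iff (algebraMap ℝ ℂ) (algebraMap ℝ ℂ).injective).mp this
  · exact absurd hT0 hne

/-! ## ★★ The zonal lemma -/

/-- ★★ **QUADRATIC GRADIENT LAW ⟹ DEGREE TWO AND ZONAL** (`Y`-currency of the VIRIAL HORN files).  A nonzero solid harmonic `Y` of degree
`l ≥ 2` with `‖∇Y‖² = a + bY + cY²` on the unit sphere has `l = 2` and is zonal: the null-cone step kills `c`, and the affine case is the
tree's `Persistence.gradSqAffineLaw`. [folklore] -/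
theorem gradSqQuadraticLaw (l : ℕ) (Y : EuclideanSpace ℝ (Fin 3) → ℝ) (hl : 2 ≤ l) (hY : IsSolidHarmonic l Y) (hne : ∃ y, Y y ≠ 0)
    (hlaw : ∃ a b c : ℝ, ∀ y : EuclideanSpace ℝ (Fin 3), ‖y‖ = 1 → ‖gradient Y y‖ ^ 2 = a + b * Y y + c * Y y ^ 2) :
    l = 2 ∧ IsZonal Y := by
  obtain ⟨a, b, c, hlaw⟩ := hlaw
  obtain ⟨P, hP, hlap, rfl⟩ := hY.exists_evalE
  have h0 : P ≠ 0 := by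
    rintro rfl
    obtain ⟨y, hy⟩ := hne
    exact hy (by simp [Zonal.evalE])
  have hc : c = 0 := sphereLaw_coeff_sq_eq_zero (by omega) hP hlap h0 hlaw
  exact gradSqAffineLaw l (Zonal.evalE P) hl hY hne ⟨b, a, fun y hy => by rw [hlaw y hy, hc]; ring⟩

/-- ★★ **THE ZONAL LEMMA** (polynomial currency of the rung).  `P` a real homogeneous polynomial of degree `l ≥ 2`, `P ≠ 0`, `lapP P = 0`,
with `‖∇P‖² = a + bP + cP²` on `S²` ⟹ `l = 2` and the function `P` is zonal (`IsZonal`: rotation-invariant about some axis). [folklore] -/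
theorem zonalLemma (hl : 2 ≤ l) (hP : P.IsHomogeneous l) (hlap : Zonal.lapP P = 0) (h0 : P ≠ 0)
    (hlaw : ∀ y : EuclideanSpace ℝ (Fin 3), ‖y‖ = 1 →
      ‖gradient (Zonal.evalE P) y‖ ^ 2 = a + b * Zonal.evalE P y + c * Zonal.evalE P y ^ 2) :
    l = 2 ∧ IsZonal (Zonal.evalE P) := by
  have hne : ∃ y, Zonal.evalE P y ≠ 0 :=
    Classical.by_contradiction fun h => h0 (Zonal.eq_zero_of_evalE_eq_zero fun y => not_not.mp (not_exists.mp h y))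
  exact gradSqQuadraticLaw l (Zonal.evalE P) hl (isSolidHarmonic_evalE hP hlap) hne ⟨a, b, c, hlaw⟩

/-- ★★ THE ZONAL LEMMA in the letter of `StubSingleDegreeRung`: the polynomial FUNCTION `z ↦ eval z P`, harmonicity through Mathlib's
`Laplacian.laplacian`, non-vanishing at a point; conclusion `l = 2` and zonality written out (`det[e, y, ∇P(y)] ≡ 0` for some `e ≠ 0`).
[folklore] -/
theorem zonalLemma_of_laplacian (hl : 2 ≤ l) (hP : P.IsHomogeneous l)
    (hlap : ∀ y : EuclideanSpace ℝ (Fin 3),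
      Laplacian.laplacian (fun z : EuclideanSpace ℝ (Fin 3) => MvPolynomial.eval (fun i => z i) P) y = 0)
    (h0 : ∃ y : EuclideanSpace ℝ (Fin 3), MvPolynomial.eval (fun i => y i) P ≠ 0)
    (hlaw : ∃ a b c : ℝ, ∀ y : EuclideanSpace ℝ (Fin 3), ‖y‖ = 1 →
      ‖gradient (fun z : EuclideanSpace ℝ (Fin 3) => MvPolynomial.eval (fun i => z i) P) y‖ ^ 2
        = a + b * MvPolynomial.eval (fun i => y i) P + c * MvPolynomial.eval (fun i => y i) P ^ 2) :
    l = 2 ∧ ∃ e : EuclideanSpace ℝ (Fin 3), e ≠ 0 ∧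
      ∀ y : EuclideanSpace ℝ (Fin 3), det3 e y (gradient (fun z : EuclideanSpace ℝ (Fin 3) => MvPolynomial.eval (fun i => z i) P) y) = 0 := by
  have hlapP : Zonal.lapP P = 0 := by
    apply Zonal.eq_zero_of_evalE_eq_zero
    intro y
    rw [← Zonal.laplacian_evalE]
    exact hlap y
  exact gradSqQuadraticLaw l (Zonal.evalE P) hl (isSolidHarmonic_evalE hP hlapP) h0 hlaw

/-- **NO QUADRATIC SPHERE LAW IN DEGREE `≥ 3`**: a nonzero real solid harmonic of degree `l ≥ 3` never has `‖∇P‖² ∈ span{1, P, P²}` on `S²`.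
[folklore] -/
theorem not_quadraticSphereLaw_of_three_le (hl : 3 ≤ l) (hP : P.IsHomogeneous l) (hlap : Zonal.lapP P = 0) (h0 : P ≠ 0) :
    ¬ ∃ a b c : ℝ, ∀ y : EuclideanSpace ℝ (Fin 3), ‖y‖ = 1 →
      ‖gradient (Zonal.evalE P) y‖ ^ 2 = a + b * Zonal.evalE P y + c * Zonal.evalE P y ^ 2 := by
  rintro ⟨a, b, c, hlaw⟩
  have h := (zonalLemma (by omega) hP hlap h0 hlaw).1
  omega

end Summit.NavierStokesRegularity.NavierStokesRegularity.Theorems.PoloidalLiouville.Antidynamo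

end
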